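import Summits.QuantumFields.BalabanUV.T4Continuum.Support.ShellMeasureLandauHolonomyChart
import Literature.Analysis.Calculus.ParametricContraction

/-!
# `T4Continuum.ShellMeasureLandauHolonomyContinuity` — TOWARDS END-II's `hcont` FOR THE CANONICAL LANDAU HOLONOMY:
# continuous dependence of B11 Prop. 6's solution and of Sect. C's Landau correction on their data (the contraction
# principle WITH A PARAMETER) and continuity of the holonomy defined in `ShellMeasureLandauHolonomyChart` on the
# chart cube
(cell `pub-balaban`, sub-cell `t4`, spine estimate NE7c (node U5b); NE7c formalisation swarm, crew seat
`b2b-balaban-t4-ne7c-formalise-leaf-05` gen 4 — file 1/2 of the REPAIR offered with FINDING F-ne7cleaf05g4-1 (XREAD of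
S22 file 7″ `ShellMeasureLandauHolonomyChart`, p212418; GAPS C-ne7cL05g4-2); imports file 7″ (p212418) and
`Literature.Analysis.Calculus.ParametricContraction` (Copson §80) ONLY; 0 def, 0 `def … : Prop`, 0 sorry; file 2/2 =
`ShellMeasureLandauHolonomyClamp`: the clamp device and E2′ with `hcont` weakened to continuity on the cube)

HONEST FRAMING.  Finite four-torus programme, rung (B)+1 only — NOT infinite volume, NOT a mass gap, NOT the Clay
problem, NOT summit progress; (B), `BetaPertHyp`, (B^μ) not consumed.  NE7c (`T4IndicatorShell.ShellWeightBound`) is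
NOT PRINTED and NOT PROVED; «NE7c ⇐ the named binders».  Nothing printed in [Balaban1985Variational] is asserted: (P2),
(P4), (118)/(121), (44)+[4] Prop. 7, (46), (54), (75)/(103) are TYPED HYPOTHESES, by name, exactly as in the imported
files.

WHY THIS FILE.  END-II (`ShellMeasureLevelAssembly.slotAntiConcentration_of_levelData`) and its realized `_cube` form
E2′ (`ShellMeasureRootCompositionLevelZero.slotAC_realized_su2_of_levelData_cube`) carry, next to (AN-bound) `hAN` and
the dictionary `hudict`, the binder `hcont : ∀ V, ∀ p ∈ P_u, Continuous (hol V p)` — GLOBAL continuity of the plaquette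
holonomy as a function on the chart space `Fin n → ℝ` (used once, for the measurability of the classifier).  While
`hol` was a FREE function this was an innocuous displayed binder.  Files 7′/7″ (`ShellMeasureLandauHolonomy`,
`ShellMeasureLandauHolonomyChart`) DEFINE the holonomy from the scheme data (`solAt`, `corrAt`, `landauExp`, `holOf`)
and inhabit `hAN` for it; for THAT `hol` the binder `hcont` is an obligation which, as typed, is not derivable from the
displayed data (the coarse-field map `Φ` is arbitrary off its polydisc of analyticity, and `solAt`/`corrAt` are
`Classical.epsilon` junk off the scheme's region).  This file supplies what IS derivable:
* §1 `continuousOn_solAt` — THE SOLUTION OF B11 PROP. 6's SCHEME DEPENDS CONTINUOUSLY ON THE DATA `(J, 𝔄)` on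
  `{‖J‖ ≤ j} × {‖𝔄‖ < a}`: the contraction principle with a parameter
  (`Literature.Analysis.Calculus.exists_fixedPoint_continuousOn_of_isClosed`, [Copson 1968, §80]) fed by the
  self-map (118) `B11Prop6Scheme.mapsTo_118` and the contraction (120) `B11Prop6Scheme.lipschitz_120` BY NAME, plus
  continuity of the transformation in the data (`continuousOn_mapT`, from (P4)'s Fréchet analyticity).  (The tree's
  `B11Prop6Scheme.solution_analytic` is holomorphy in ONE complex parameter; joint dependence on the Banach data is
  listed there as not typed — this is its continuous half.)
* §2 `continuousOn_corrAt`, `continuousOn_landauExp` — THE LANDAU CORRECTION `D(Y)` (fixed point of (50)) AND THE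
  LANDAU EXPONENT `Y − H D(Y)` DEPEND CONTINUOUSLY ON `Y` on `{‖Y‖ < ε}`: the same principle fed by
  `B13Contraction113.mapsTo_T` / `lipschitz_T` BY NAME ((53)–(54)).
* §3 `continuousOn_holOf` (words of exponentials of read-outs of a continuous exponent field are continuous) and
  `continuousOn_landauHol_chartRay` — THE HOLONOMY DEFINED IN FILE 7″ §3 IS CONTINUOUS ON THE CHART CUBE `[-S,S]ⁿ`
  under file 7″'s own binders ((P2), (P4), (118)/(121) at `(j, θ, a) = (0, 0, B₀b)`, (44), (46), (54), `Φ` holomorphic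
  and bounded on the polydisc `‖z‖ < r_Φ`, `0 < S < r_Φ`) — no new binder.
File 2/2 (`ShellMeasureLandauHolonomyClamp`) turns continuity ON THE CUBE into E2′'s global `hcont` by composing the
holonomy with the coordinatewise clamp onto the cube (E2′'s `hudict`/`hRdict` are asked on the cube only, and the
contraction rays of cube points stay in the cube).  What stays displayed is unchanged: (P2), (P4), the numbers,
(44)/(46)/(54), the ray/coarse-field data, the read-outs, END-II's `hudict`, SM-L2…L6; NE7c NOT PROVED; spine PROVED
0/9.  HONEST DEPENDENCY (cell): continuum YM on T⁴ ⇐ BetaPertH ∧ nine spine estimates (0/9 proved); BetaPertH ⇐ (D1)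
∧ (D4) ∧ CAP+tail; G-an2-4 gates asym, D1 and NE2/3/4.
-/

noncomputable section

open Set Metric NormedSpace Function MeasureTheory

namespace Summit.QuantumFields.BalabanUV.T4Continuum.ShellMeasureLandauHolonomyContinuity

open scoped ENNReal NNReal
open Literature.MathematicalPhysics.QuantumFieldTheory.Balaban1983to89
open B11Prop6Scheme (mapT Prop4Hyp norm_arg_lt mapsTo_118 lipschitz_120 existsUnique_solution)
open B13Contraction113 (QuadAnalytic mapsTo_T lipschitz_T)
open T4CubePoincare (cube mem_cube_iff)
open ShellMeasureWilsonWords (wordExp wordExp_nil wordExp_cons)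
open ShellMeasureLandauFixedPoint (quadAnalytic_of_frechet)
open ShellMeasureLandauHolonomy (solAt corrAt landauExp solAt_spec solAt_eq_of_unique corrAt_eq_of_unique)
open ShellMeasureLandauHolonomyChart (holOf cplx holOf_apply norm_cplx_le)
open Literature.Analysis.Calculus (exists_fixedPoint_continuousOn_of_isClosed)

variable {𝒴 𝒴' 𝒳 𝒵 : Type*} [NormedAddCommGroup 𝒴] [NormedSpace ℂ 𝒴] [NormedAddCommGroup 𝒴'] [NormedSpace ℂ 𝒴']
  [NormedAddCommGroup 𝒳] [NormedSpace ℂ 𝒳] [NormedAddCommGroup 𝒵] [NormedSpace ℂ 𝒵]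

/-! ## §1 The scheme's solution depends continuously on the data -/

section Scheme

variable {𝒢 : 𝒵 →L[ℂ] 𝒴} {Λ : 𝒴 →L[ℂ] 𝒴} {W : 𝒴 → 𝒵} {B₀ θ C₄ a₃ : ℝ}

omit [NormedAddCommGroup 𝒴'] [NormedSpace ℂ 𝒴'] [NormedAddCommGroup 𝒳] [NormedSpace ℂ 𝒳] in
/-- **THE TRANSFORMATION IS CONTINUOUS IN THE DATA.**  For a point `X` of the ball `‖X‖ ≤ ε₄` the map
`(J, 𝔄) ↦ mapT 𝒢 Λ W J 𝔄 X = −𝒢 J + Λ (X + 𝔄) − 𝒢 (W (X + 𝔄))` is continuous on `{‖J‖ ≤ j} × {‖𝔄‖ < a}` — (P4)'s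
Fréchet analyticity of `W` on `‖Y‖ < a₃` gives continuity there, and `‖X + 𝔄‖ < ε₄ + a ≤ a₃` by the domain condition
`2(ε₄ + a) ≤ a₃`. [folklore] -/
theorem continuousOn_mapT (hW : Prop4Hyp W C₄ a₃) {j a ε₄ : ℝ} (hdom : 2 * (ε₄ + a) ≤ a₃) {X : 𝒴}
    (hX : ‖X‖ ≤ ε₄) :
    ContinuousOn (fun d : 𝒵 × 𝒴 => mapT 𝒢 Λ W d.1 d.2 X) {d | ‖d.1‖ ≤ j ∧ ‖d.2‖ < a} := by
  have h1 : Continuous fun d : 𝒵 × 𝒴 => -𝒢 d.1 + Λ (X + d.2) :=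
    (𝒢.continuous.comp continuous_fst).neg.add (Λ.continuous.comp (continuous_const.add continuous_snd))
  have hin : MapsTo (fun d : 𝒵 × 𝒴 => X + d.2) {d | ‖d.1‖ ≤ j ∧ ‖d.2‖ < a} {Y : 𝒴 | ‖Y‖ < a₃} := by
    intro d hd
    have hlt : ‖X + d.2‖ < ε₄ + a := norm_arg_lt hd.2 hX
    have h0 : 0 ≤ ‖X + d.2‖ := norm_nonneg _
    show ‖X + d.2‖ < a₃
    linarith
  have h3 : ContinuousOn (fun d : 𝒵 × 𝒴 => 𝒢 (W (X + d.2))) {d | ‖d.1‖ ≤ j ∧ ‖d.2‖ < a} :=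
    𝒢.continuous.comp_continuousOn
      (hW.differentiableOn.continuousOn.comp (continuous_const.add continuous_snd).continuousOn hin)
  exact (h1.continuousOn.sub h3).congr fun d _ => rfl

/-- **THE SOLUTION OF B11 PROP. 6's SCHEME DEPENDS CONTINUOUSLY ON THE DATA** — the continuous half of «the solution is
an analytic function of 𝔄» ([Balaban1985Variational] Prop. 6 p. 296) jointly in the Banach data.  Under (P2) `h𝒢`/`hΛ`,
(P4) `hW`, the numbers (118)/(121) (`hdom`, `hself`, `hcontr`): the canonical solution
`(J, 𝔄) ↦ solAt 𝒢 Λ W ε₄ J 𝔄` (THE solution in `‖X‖ ≤ ε₄`) is continuous on `{‖J‖ ≤ j} × {‖𝔄‖ < a}`.  Proof: the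
contraction principle WITH A PARAMETER (`Literature.Analysis.Calculus.exists_fixedPoint_continuousOn_of_isClosed`,
Copson §80) on the closed ball, fed by `B11Prop6Scheme.mapsTo_118` (self-map), `B11Prop6Scheme.lipschitz_120` (uniform
contraction `θ + 4B₀C₄(ε₄+a) < 1`) and `continuousOn_mapT`; the continuous fixed-point map IS `solAt` by uniqueness in
the ball (`solAt_eq_of_unique`). [folklore] -/
theorem continuousOn_solAt [CompleteSpace 𝒴] (h𝒢 : ∀ f, ‖𝒢 f‖ ≤ B₀ * ‖f‖) (hΛ : ∀ Y, ‖Λ Y‖ ≤ θ * ‖Y‖)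
    (hW : Prop4Hyp W C₄ a₃) (hB₀ : 0 ≤ B₀) (hC₄ : 0 ≤ C₄) (hθ : 0 ≤ θ) {j a ε₄ : ℝ} (hε₄ : 0 ≤ ε₄)
    (hdom : 2 * (ε₄ + a) ≤ a₃) (hself : B₀ * j + θ * (ε₄ + a) + B₀ * C₄ * (ε₄ + a) ^ 2 ≤ ε₄)
    (hcontr : θ + 4 * B₀ * C₄ * (ε₄ + a) < 1) :
    ContinuousOn (fun d : 𝒵 × 𝒴 => solAt 𝒢 Λ W ε₄ d.1 d.2) {d | ‖d.1‖ ≤ j ∧ ‖d.2‖ < a} := by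
  set S : Set (𝒵 × 𝒴) := {d | ‖d.1‖ ≤ j ∧ ‖d.2‖ < a} with hS
  rcases S.eq_empty_or_nonempty with hSe | ⟨d₀, hd₀⟩
  · rw [hSe]; exact continuousOn_empty _
  have ha : 0 < a := (norm_nonneg _).trans_lt hd₀.2
  have hq0 : 0 ≤ θ + 4 * B₀ * C₄ * (ε₄ + a) := by positivity
  have hWq : QuadAnalytic W C₄ a₃ := hW.quadAnalytic
  have hdom1 : ε₄ + a ≤ a₃ := by linarith
  set K : ℝ≥0 := ⟨θ + 4 * B₀ * C₄ * (ε₄ + a), hq0⟩ with hK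
  have hK1 : K < 1 := by
    change (⟨θ + 4 * B₀ * C₄ * (ε₄ + a), hq0⟩ : ℝ≥0) < 1
    exact_mod_cast hcontr
  have hmaps : ∀ d ∈ S, MapsTo (fun X => mapT 𝒢 Λ W d.1 d.2 X) (closedBall (0 : 𝒴) ε₄) (closedBall 0 ε₄) := by
    intro d hd X hX
    rw [mem_closedBall_zero_iff] at hX ⊢
    exact mapsTo_118 h𝒢 hΛ hWq hB₀ hC₄ hθ hd.1 hd.2 hdom1 hself X hX
  have hlip : ∀ d ∈ S, LipschitzOnWith K (fun X => mapT 𝒢 Λ W d.1 d.2 X) (closedBall (0 : 𝒴) ε₄) := by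
    intro d hd
    refine LipschitzOnWith.of_dist_le_mul fun X hX X' hX' => ?_
    rw [dist_eq_norm, dist_eq_norm]
    show ‖mapT 𝒢 Λ W d.1 d.2 X - mapT 𝒢 Λ W d.1 d.2 X'‖ ≤ (θ + 4 * B₀ * C₄ * (ε₄ + a)) * ‖X - X'‖
    exact lipschitz_120 (J := d.1) h𝒢 hΛ hWq hB₀ hC₄ hd.2 hε₄ hdom (mem_closedBall_zero_iff.1 hX)
      (mem_closedBall_zero_iff.1 hX')
  have hc : ∀ X ∈ closedBall (0 : 𝒴) ε₄, ContinuousOn (fun d : 𝒵 × 𝒴 => mapT 𝒢 Λ W d.1 d.2 X) S :=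
    fun X hX => continuousOn_mapT hW hdom (mem_closedBall_zero_iff.1 hX)
  obtain ⟨α, hαc, hαfix, hαuniq⟩ := exists_fixedPoint_continuousOn_of_isClosed
    (T := fun (d : 𝒵 × 𝒴) X => mapT 𝒢 Λ W d.1 d.2 X) isClosed_closedBall ⟨0, mem_closedBall_self hε₄⟩ hK1 hmaps
    hlip hc
  refine hαc.congr fun d hd => ?_
  exact solAt_eq_of_unique (mem_closedBall_zero_iff.1 (hαfix d hd).1) (hαfix d hd).2
    fun X' hX' hfix' => hαuniq d hd X' (mem_closedBall_zero_iff.2 hX') hfix'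

end Scheme

/-! ## §2 The Landau correction and the Landau exponent depend continuously on `Y` -/

section Corr

variable [CompleteSpace 𝒳]

omit [NormedAddCommGroup 𝒵] [NormedSpace ℂ 𝒵] [CompleteSpace 𝒳] in
/-- **THE MAP OF (50) IS CONTINUOUS IN `Y`.**  For `X` in the closed ball `4C₂ε²` (so `‖ι H X‖ ≤ ε` under `4C₂B₀ε ≤ 1`),
`Y ↦ C (ι Y − ι (H X))` is continuous on `{‖Y‖ < ε}`: the argument has norm `< 2ε ≤ R` and `C` is Fréchet-analytic,
hence continuous, on `ball 0 R` ((44)+[4] Prop. 7 TYPE `hCd`). [folklore] -/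
theorem continuousOn_landauMap {C : 𝒴' → 𝒳} {R : ℝ} (hCd : DifferentiableOn ℂ C (ball 0 R)) (ι : 𝒴 →L[ℂ] 𝒴')
    (hι : ∀ Y, ‖ι Y‖ ≤ ‖Y‖) (H : 𝒳 →L[ℂ] 𝒴) {B₀ : ℝ} (hB₀ : 0 ≤ B₀) (hH : ∀ X, ‖H X‖ ≤ B₀ * ‖X‖) {C₂ ε : ℝ}
    (hR2 : 4 * C₂ * B₀ * ε ≤ 1) (hRC : 2 * ε ≤ R) {X : 𝒳} (hX : X ∈ closedBall (0 : 𝒳) (4 * C₂ * ε ^ 2)) :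
    ContinuousOn (fun Y : 𝒴 => C (ι Y - ι (H X))) {Y | ‖Y‖ < ε} := by
  have hin : MapsTo (fun Y : 𝒴 => ι Y - ι (H X)) {Y | ‖Y‖ < ε} (ball (0 : 𝒴') R) := by
    intro Y hY
    have hYε : ‖Y‖ < ε := hY
    have hε : 0 ≤ ε := (norm_nonneg _).trans hYε.le
    have hXn : ‖X‖ ≤ 4 * C₂ * ε ^ 2 := mem_closedBall_zero_iff.1 hX
    have hHX : ‖ι (H X)‖ ≤ ε := by
      calc ‖ι (H X)‖ ≤ B₀ * ‖X‖ := (hι _).trans (hH X)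
        _ ≤ B₀ * (4 * C₂ * ε ^ 2) := mul_le_mul_of_nonneg_left hXn hB₀
        _ = (4 * C₂ * B₀ * ε) * ε := by ring
        _ ≤ 1 * ε := mul_le_mul_of_nonneg_right hR2 hε
        _ = ε := one_mul ε
    rw [mem_ball_zero_iff]
    calc ‖ι Y - ι (H X)‖ ≤ ‖ι Y‖ + ‖ι (H X)‖ := norm_sub_le _ _
      _ < ε + ε := add_lt_add_of_lt_of_le ((hι Y).trans_lt hYε) hHX
      _ ≤ R := by linarith
  exact hCd.continuousOn.comp ((ι.continuous.sub continuous_const).continuousOn) hin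

omit [NormedAddCommGroup 𝒵] [NormedSpace ℂ 𝒵] in
/-- **THE LANDAU CORRECTION DEPENDS CONTINUOUSLY ON `Y`.**  Under (44)+[4] Prop. 7 `hCq`/`hCd`, the scaling `hι`, (46)
`hH`, the (54)-smallness `9C₂B₀ε < 1` and `3ε ≤ R`: the canonical fixed point `Y ↦ corrAt C ι H (4C₂ε²) Y` of (50)
(THE fixed point in the closed ball `4C₂ε²`, [Balaban1985Variational] p. 286) is continuous on `{‖Y‖ < ε}` — the
contraction principle with a parameter fed by `B13Contraction113.mapsTo_T` / `lipschitz_T` BY NAME and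
`continuousOn_landauMap`; identification with `corrAt` by `corrAt_eq_of_unique`. [folklore] -/
theorem continuousOn_corrAt {C : 𝒴' → 𝒳} {C₂ R : ℝ} (hC₂ : 0 ≤ C₂)
    (hCq : ∀ Z : 𝒴', ‖Z‖ < R → ‖C Z‖ ≤ C₂ * ‖Z‖ ^ 2) (hCd : DifferentiableOn ℂ C (ball 0 R))
    (ι : 𝒴 →L[ℂ] 𝒴') (hι : ∀ Y, ‖ι Y‖ ≤ ‖Y‖) (H : 𝒳 →L[ℂ] 𝒴) {B₀ : ℝ} (hB₀ : 0 ≤ B₀)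
    (hH : ∀ X, ‖H X‖ ≤ B₀ * ‖X‖) {ε : ℝ} (hq : 9 * C₂ * B₀ * ε < 1) (hRC : 3 * ε ≤ R) :
    ContinuousOn (fun Y : 𝒴 => corrAt C ι H (4 * C₂ * ε ^ 2) Y) {Y | ‖Y‖ < ε} := by
  set S : Set 𝒴 := {Y | ‖Y‖ < ε} with hS
  rcases S.eq_empty_or_nonempty with hSe | ⟨Y₀, hY₀⟩
  · rw [hSe]; exact continuousOn_empty _
  have hε : 0 < ε := (norm_nonneg _).trans_lt hY₀
  have hK0 : 0 ≤ 9 * C₂ * B₀ * ε := by positivity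
  have hR2 : 4 * C₂ * B₀ * ε ≤ 1 := by nlinarith
  have hRC2 : 2 * ε ≤ R := by linarith
  have hC : QuadAnalytic C C₂ R := quadAnalytic_of_frechet hCq hCd
  set Hop : 𝒳 →ₗ[ℂ] 𝒴' := ((ι.comp H : 𝒳 →L[ℂ] 𝒴') : 𝒳 →ₗ[ℂ] 𝒴') with hHop'
  have hHop : ∀ X, ‖Hop X‖ ≤ B₀ * ‖X‖ := fun X => (hι _).trans (hH X)
  have hA : ∀ Y ∈ S, ‖ι Y‖ < ε := fun Y hY => (hι Y).trans_lt hY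
  set K : ℝ≥0 := ⟨9 * C₂ * B₀ * ε, hK0⟩ with hK
  have hK1 : K < 1 := by
    change (⟨9 * C₂ * B₀ * ε, hK0⟩ : ℝ≥0) < 1
    exact_mod_cast hq
  have hmaps : ∀ Y ∈ S, MapsTo (fun X => C (ι Y - Hop X)) (closedBall (0 : 𝒳) (4 * C₂ * ε ^ 2))
      (closedBall (0 : 𝒳) (4 * C₂ * ε ^ 2)) := fun Y hY => mapsTo_T hC hC₂ hB₀ hHop (hA Y hY) hR2 hRC2
  have hlip : ∀ Y ∈ S, LipschitzOnWith K (fun X => C (ι Y - Hop X)) (closedBall (0 : 𝒳) (4 * C₂ * ε ^ 2)) := by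
    intro Y hY
    refine LipschitzOnWith.of_dist_le_mul fun X hX X' hX' => ?_
    rw [dist_eq_norm, dist_eq_norm]
    show ‖C (ι Y - Hop X) - C (ι Y - Hop X')‖ ≤ (9 * C₂ * B₀ * ε) * ‖X - X'‖
    exact lipschitz_T hC hC₂ hB₀ hHop (hA Y hY) hR2 hRC hX hX'
  have hc : ∀ X ∈ closedBall (0 : 𝒳) (4 * C₂ * ε ^ 2), ContinuousOn (fun Y : 𝒴 => C (ι Y - Hop X)) S :=
    fun X hX => continuousOn_landauMap hCd ι hι H hB₀ hH hR2 hRC2 hX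
  obtain ⟨α, hαc, hαfix, hαuniq⟩ := exists_fixedPoint_continuousOn_of_isClosed
    (T := fun (Y : 𝒴) X => C (ι Y - Hop X)) isClosed_closedBall ⟨0, mem_closedBall_self (by positivity)⟩ hK1
    hmaps hlip hc
  refine hαc.congr fun Y hY => ?_
  exact corrAt_eq_of_unique (hαfix Y hY).1 (hαfix Y hY).2 fun X'' hX'' hfix'' => hαuniq Y hY X'' hX'' hfix''

omit [NormedAddCommGroup 𝒵] [NormedSpace ℂ 𝒵] in
/-- **THE LANDAU EXPONENT `Ψ̂(Y) = Y − H D(Y)` DEPENDS CONTINUOUSLY ON `Y`** on `{‖Y‖ < ε}` (same binders as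
`continuousOn_corrAt`). [folklore] -/
theorem continuousOn_landauExp {C : 𝒴' → 𝒳} {C₂ R : ℝ} (hC₂ : 0 ≤ C₂)
    (hCq : ∀ Z : 𝒴', ‖Z‖ < R → ‖C Z‖ ≤ C₂ * ‖Z‖ ^ 2) (hCd : DifferentiableOn ℂ C (ball 0 R))
    (ι : 𝒴 →L[ℂ] 𝒴') (hι : ∀ Y, ‖ι Y‖ ≤ ‖Y‖) (H : 𝒳 →L[ℂ] 𝒴) {B₀ : ℝ} (hB₀ : 0 ≤ B₀)
    (hH : ∀ X, ‖H X‖ ≤ B₀ * ‖X‖) {ε : ℝ} (hq : 9 * C₂ * B₀ * ε < 1) (hRC : 3 * ε ≤ R) :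
    ContinuousOn (fun Y : 𝒴 => landauExp C ι H (4 * C₂ * ε ^ 2) Y) {Y | ‖Y‖ < ε} :=
  continuousOn_id.sub (H.continuous.comp_continuousOn (continuousOn_corrAt hC₂ hCq hCd ι hι H hB₀ hH hq hRC))

end Corr

/-! ## §3 Words of exponentials of a continuous exponent field; the 7″ holonomy on the chart cube -/

section Hol

variable {E : Type*} [TopologicalSpace E] {A : Type*} [NormedRing A] [NormedAlgebra ℂ A] [CompleteSpace A]

/-- the exponential of a complete normed `ℂ`-algebra is continuous (entire). [folklore] -/
theorem continuous_expA : Continuous (exp : A → A) :=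
  continuous_iff_continuousAt.2 fun x => (NormedSpace.exp_analytic (𝕂 := ℂ) x).continuousAt

omit [NormedAddCommGroup 𝒴'] [NormedSpace ℂ 𝒴'] [NormedAddCommGroup 𝒳] [NormedSpace ℂ 𝒳] [NormedAddCommGroup 𝒵]
  [NormedSpace ℂ 𝒵] in
/-- the word of exponentials of the read-outs of a continuous exponent field is continuous. [folklore] -/
theorem continuousOn_wordExp_map {s : Set E} {Z : E → 𝒴} (hZ : ContinuousOn Z s) :
    ∀ ℓs : List (𝒴 →L[ℂ] A), ContinuousOn (fun y => wordExp (ℓs.map fun ℓ => ℓ (Z y))) s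
  | [] => by simpa only [List.map_nil, wordExp_nil] using continuousOn_const
  | ℓ :: ℓs => by
      have h1 : ContinuousOn (fun y => exp (ℓ (Z y))) s :=
        continuous_expA.comp_continuousOn (ℓ.continuous.comp_continuousOn hZ)
      have h2 : ContinuousOn (fun y => exp (ℓ (Z y)) * wordExp (ℓs.map fun ℓ => ℓ (Z y))) s :=
        h1.mul (continuousOn_wordExp_map hZ ℓs)
      simpa only [List.map_cons, wordExp_cons] using h2

omit [NormedAddCommGroup 𝒴'] [NormedSpace ℂ 𝒴'] [NormedAddCommGroup 𝒳] [NormedSpace ℂ 𝒳] [NormedAddCommGroup 𝒵]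
  [NormedSpace ℂ 𝒵] in
/-- **`holOf ℓs Z` IS CONTINUOUS WHERE THE EXPONENT FIELD `Z` IS.** [folklore] -/
theorem continuousOn_holOf {s : Set E} {Z : E → 𝒴} (hZ : ContinuousOn Z s) (ℓs : List (𝒴 →L[ℂ] A)) :
    ContinuousOn (holOf ℓs Z) s :=
  continuousOn_wordExp_map hZ ℓs

end Hol

section ChartRay

variable {n : ℕ} {ℬ : Type*} [NormedAddCommGroup ℬ] [NormedSpace ℂ ℬ]

omit [NormedSpace ℂ ℬ] in
/-- the chart cube `[-S,S]ⁿ` (`0 < S < r_Φ`) complexifies into the polydisc `‖z‖ < r_Φ`. [folklore] -/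
theorem cplx_mapsTo_ball {S rΦ : ℝ} (hS : 0 < S) (hSr : S < rΦ) :
    MapsTo (cplx : (Fin n → ℝ) → Fin n → ℂ) (cube n S) (ball (0 : Fin n → ℂ) rΦ) := by
  intro y hy
  rw [mem_cube_iff] at hy
  have hyn : ‖y‖ ≤ S := (pi_norm_le_iff_of_nonneg hS.le).2 fun i => by rw [Real.norm_eq_abs]; exact hy i
  rw [mem_ball_zero_iff]
  exact ((norm_cplx_le y).trans hyn).trans_lt hSr

/-- the coarse datum `y ↦ H₁ (Φ (cplx y))` is continuous on the cube when `Φ` is holomorphic on the polydisc and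
`0 < S < r_Φ` ((75)/(103) TYPE). [folklore] -/
theorem continuousOn_coarseDatum (H₁ : ℬ →L[ℂ] 𝒴) {Φ : (Fin n → ℂ) → ℬ} {rΦ S : ℝ}
    (hΦd : DifferentiableOn ℂ Φ (ball 0 rΦ)) (hS : 0 < S) (hSr : S < rΦ) :
    ContinuousOn (fun y : Fin n → ℝ => H₁ (Φ (cplx y))) (cube n S) :=
  have hc : Continuous (cplx : (Fin n → ℝ) → Fin n → ℂ) :=
    continuous_pi fun i => Complex.continuous_ofReal.comp (continuous_apply i)
  H₁.continuous.comp_continuousOn (hΦd.continuousOn.comp hc.continuousOn (cplx_mapsTo_ball hS hSr))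

variable {A : Type*} [NormedRing A] [NormedAlgebra ℂ A] [CompleteSpace A] [CompleteSpace 𝒴] [CompleteSpace 𝒳]
  {𝒢 : 𝒵 →L[ℂ] 𝒴} {W𝒱 : 𝒴 → 𝒵} {B₀ C₄ a₃ : ℝ}

/-- **THE HOLONOMY DEFINED IN FILE 7″ §3 IS CONTINUOUS ON THE CHART CUBE.**  Under the binders of
`ShellMeasureLandauHolonomyChart.hAN_landau_chartRay` that concern the data (window half-side `0 < S`; (P2) `h𝒢`; (P4)
`hW`; the numbers (118)/(121) at `(j, θ, a) = (0, 0, B₀b)`; (103) `hH₁`; `Φ` holomorphic on the polydisc `‖z‖ < r_Φ` with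
`‖Φ z‖ < b` ((75) TYPE) and `S < r_Φ`; (44)+[4] Prop. 7 `hCq`/`hCd`; scaling `hι`; (46) `hH`; (54)-smallness at
`ε₄ + B₀b`) the holonomy `holOf ℓs (y ↦ landauExp C ι H (4C₂(ε₄+B₀b)²) (solAt 𝒢 0 W𝒱 ε₄ 0 (H₁ (Φ (cplx y))) + H₁ (Φ (cplx
y))))` of ANY read-out list `ℓs` is continuous on `cube n S` — §1 ∘ §2 ∘ §3.  This is the `hcontOn` binder of file 2's
`ShellMeasureLandauHolonomyClamp.slotAC_realized_su2_of_levelData_cube_contOn` for the 7″ holonomy. [folklore] -/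
theorem continuousOn_landauHol_chartRay {S : ℝ} (hS : 0 < S)
    (h𝒢 : ∀ f, ‖𝒢 f‖ ≤ B₀ * ‖f‖) (hW : Prop4Hyp W𝒱 C₄ a₃) (hB₀ : 0 < B₀) (hC₄ : 0 ≤ C₄)
    {b ε₄ : ℝ} (hε₄ : 0 ≤ ε₄) (hdom : 2 * (ε₄ + B₀ * b) ≤ a₃)
    (hself : B₀ * C₄ * (ε₄ + B₀ * b) ^ 2 ≤ ε₄) (hcontr : 4 * B₀ * C₄ * (ε₄ + B₀ * b) < 1)
    (H₁ : ℬ →L[ℂ] 𝒴) (hH₁ : ∀ B, ‖H₁ B‖ ≤ B₀ * ‖B‖)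
    {Φ : (Fin n → ℂ) → ℬ} {rΦ : ℝ} (hΦd : DifferentiableOn ℂ Φ (ball 0 rΦ))
    (hΦ : ∀ z ∈ ball (0 : Fin n → ℂ) rΦ, ‖Φ z‖ < b) (hSr : S < rΦ)
    {C : 𝒴' → 𝒳} {C₂ R : ℝ} (hC₂ : 0 ≤ C₂) (hCq : ∀ Z : 𝒴', ‖Z‖ < R → ‖C Z‖ ≤ C₂ * ‖Z‖ ^ 2)
    (hCd : DifferentiableOn ℂ C (ball 0 R)) (ι : 𝒴 →L[ℂ] 𝒴') (hι : ∀ Y, ‖ι Y‖ ≤ ‖Y‖) (H : 𝒳 →L[ℂ] 𝒴)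
    (hH : ∀ X, ‖H X‖ ≤ B₀ * ‖X‖) (hq : 9 * C₂ * B₀ * (ε₄ + B₀ * b) < 1) (hRC : 3 * (ε₄ + B₀ * b) ≤ R)
    (ℓs : List (𝒴 →L[ℂ] A)) :
    ContinuousOn (holOf ℓs (fun y => landauExp C ι H (4 * C₂ * (ε₄ + B₀ * b) ^ 2)
      (solAt 𝒢 0 W𝒱 ε₄ (0 : 𝒵) (H₁ (Φ (cplx y))) + H₁ (Φ (cplx y))))) (cube n S) := by
  -- the coarse datum on the cube and its size
  have hdat : ContinuousOn (fun y : Fin n → ℝ => H₁ (Φ (cplx y))) (cube n S) :=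
    continuousOn_coarseDatum H₁ hΦd hS hSr
  have hsz : ∀ y ∈ cube n S, ‖H₁ (Φ (cplx y))‖ < B₀ * b := fun y hy =>
    (hH₁ _).trans_lt (mul_lt_mul_of_pos_left (hΦ _ (cplx_mapsTo_ball hS hSr hy)) hB₀)
  -- §1: the canonical solution is continuous in the data (Λ = 0, J ≡ 0)
  have hΛ : ∀ Y : 𝒴, ‖(0 : 𝒴 →L[ℂ] 𝒴) Y‖ ≤ 0 * ‖Y‖ := fun Y => by
    rw [zero_apply, norm_zero, zero_mul]
  have hself' : B₀ * 0 + 0 * (ε₄ + B₀ * b) + B₀ * C₄ * (ε₄ + B₀ * b) ^ 2 ≤ ε₄ := by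
    rw [mul_zero, zero_mul, zero_add, zero_add]; exact hself
  have hcontr' : 0 + 4 * B₀ * C₄ * (ε₄ + B₀ * b) < 1 := by rw [zero_add]; exact hcontr
  have hsol : ContinuousOn (fun d : 𝒵 × 𝒴 => solAt 𝒢 0 W𝒱 ε₄ d.1 d.2) {d | ‖d.1‖ ≤ 0 ∧ ‖d.2‖ < B₀ * b} :=
    continuousOn_solAt h𝒢 hΛ hW hB₀.le hC₄ le_rfl hε₄ hdom hself' hcontr'
  have hJ0 : ‖(0 : 𝒵)‖ ≤ 0 := norm_zero.le
  have hin : MapsTo (fun y : Fin n → ℝ => ((0 : 𝒵), H₁ (Φ (cplx y)))) (cube n S)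
      {d : 𝒵 × 𝒴 | ‖d.1‖ ≤ 0 ∧ ‖d.2‖ < B₀ * b} := fun y hy => ⟨hJ0, hsz y hy⟩
  have hpair : ContinuousOn (fun y : Fin n → ℝ => ((0 : 𝒵), H₁ (Φ (cplx y)))) (cube n S) :=
    continuousOn_const.prodMk hdat
  have hsolc : ContinuousOn (fun y : Fin n → ℝ => solAt 𝒢 0 W𝒱 ε₄ (0 : 𝒵) (H₁ (Φ (cplx y)))) (cube n S) := by
    have h := hsol.comp hpair hin
    exact h
  -- the curve `Y = X + 𝔄` on the cube stays in `‖Y‖ < ε₄ + B₀ b`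
  have hY : ContinuousOn (fun y : Fin n → ℝ => solAt 𝒢 0 W𝒱 ε₄ (0 : 𝒵) (H₁ (Φ (cplx y))) + H₁ (Φ (cplx y)))
      (cube n S) := hsolc.add hdat
  have hYin : MapsTo (fun y : Fin n → ℝ => solAt 𝒢 0 W𝒱 ε₄ (0 : 𝒵) (H₁ (Φ (cplx y))) + H₁ (Φ (cplx y)))
      (cube n S) {Y : 𝒴 | ‖Y‖ < ε₄ + B₀ * b} := by
    intro y hy
    have hex : ∃ X : 𝒴, ‖X‖ ≤ ε₄ ∧ mapT 𝒢 0 W𝒱 (0 : 𝒵) (H₁ (Φ (cplx y))) X = X :=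
      (existsUnique_solution h𝒢 hΛ hW.quadAnalytic hB₀.le hC₄ le_rfl hJ0 (hsz y hy) hε₄ hdom hself'
        hcontr').exists
    exact norm_arg_lt (hsz y hy) (solAt_spec hex).1
  -- §2: the Landau exponent is continuous on that ball; §3: so is the word of read-outs
  have hL : ContinuousOn (fun Y : 𝒴 => landauExp C ι H (4 * C₂ * (ε₄ + B₀ * b) ^ 2) Y)
      {Y : 𝒴 | ‖Y‖ < ε₄ + B₀ * b} := continuousOn_landauExp hC₂ hCq hCd ι hι H hB₀.le hH hq hRC
  have hZ := hL.comp hY hYin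
  exact continuousOn_holOf hZ ℓs

end ChartRay

end Summit.QuantumFields.BalabanUV.T4Continuum.ShellMeasureLandauHolonomyContinuity
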